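import Literature.NumberTheory.Automorphic.UnitaryGroupBlockCentralizer
import Literature.NumberTheory.Automorphic.UnitaryGroupDirectSumCarriersFinite
import Literature.NumberTheory.Automorphic.UnitaryGroupRestrictedProduct
import HarnessLib

/-!
# Rational points and integral levels are read BLOCKWISE along `U(J₁) × U(J₂) →* U(J₁ ⊕ᶠ J₂)`
(Platonov–Rapinchuk 1994 §5.1: `G(K) ∩ (G₁ × G₂) = G₁(K) × G₂(K)`, `G(𝒪̂) ∩ (G₁ × G₂) = G₁(𝒪̂) × G₂(𝒪̂)` for a block-diagonal
embedding of matrix groups; Rogawski 1990 §3.8 Prop. 3.8.1 (a), §14.5 L. 14.5.2 (b): the centraliser lattice of a singular semisimple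
element of `U(3)` is `U(H_a)(F) × U(H_b)(F)`)

Topic `NumberTheory/Automorphic`; namespace `Literature.NumberTheory.Automorphic.UnitaryGroup`.  THEOREMS ONLY (no definition, no
instance, no named fact, no `sorry`), over the tree's block-diagonal carriers ★ `adelicBlockDiag` ∕ `rationalBlockDiag`
(`UnitaryGroupDirectSumCarriers`), ★ `finAdelicBlockDiag` (`UnitaryGroupDirectSumCarriersFinite`), ★ `finAdelicIntegralLevel`
(`UnitaryGroupRestrictedProduct`) and ★ `mem_range_blockDiagFin_iff_commute` (`UnitaryGroupBlockCentralizer`).  Any CM extension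
`E/F` with involution `c`, any sizes `M₁, M₂`, any Gram matrices `J₁ ∈ M_{M₁}(E)`, `J₂ ∈ M_{M₂}(E)`.

* §1 (any commutative ring `S`, any `ZeroMemClass` carrier `s` — subring, subalgebra, ideal, …) **`forall_finSum_apply_mem_iff`** — the entries of `A ⊕ᶠ B` lie in `s` iff the entries of `A` and
  of `B` do (the off-diagonal blocks are `0`).
* §2 **`finAdelicBlockDiag_mem_finAdelicIntegralLevel_iff`** — `u₁ ⊕ᶠ u₂ ∈ K_f⁰(J₁ ⊕ᶠ J₂)` iff `u₁ ∈ K_f⁰(J₁)` and `u₂ ∈ K_f⁰(J₂)`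
  (`K_f⁰ = U(J)(𝔸_{F,f}) ∩ GL(𝒪̂_E)` is cut out ENTRYWISE on the matrix and its inverse, and `(u₁ ⊕ᶠ u₂)⁻¹ = u₁⁻¹ ⊕ᶠ u₂⁻¹`);
  subgroup form **`comap_finAdelicBlockDiag_finAdelicIntegralLevel`**: `(K_f⁰).comap (⊕ᶠ) = K_f⁰(J₁) ×ˢ K_f⁰(J₂)`.
* §3 **`adelicBlockDiag_mem_range_toAdelic_iff`** — `u₁ ⊕ᶠ u₂` is a RATIONAL point of `U(J₁ ⊕ᶠ J₂)(𝔸_F)` iff `u₁`, `u₂` are rational: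
  (⇐) ★ `adelicBlockDiag_toAdelic_mem_range`; (⇒) a rational `γ` with `γ ⊗ 1 = u₁ ⊕ᶠ u₂` commutes with `0 ⊕ᶠ 1` (pull back along the
  injective `E → 𝔸_E`), so `γ = γ₁ ⊕ᶠ γ₂` with `γᵢ ∈ U(Jᵢ)(F)` (★ `mem_range_blockDiagFin_iff_commute` over `E`, `a − b = −1` a unit),
  and `γᵢ ⊗ 1 = uᵢ` by injectivity of `⊕ᶠ`; subgroup form **`comap_adelicBlockDiag_range_toAdelic`**; the finite-adelic twin
  **`finAdelicBlockDiag_mem_range_rationalToFinAdelic_iff`** ∕ **`comap_finAdelicBlockDiag_range_rationalToFinAdelic`**.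
These are the two «glue» facts (lattice = product lattice, box = product of boxes) under which ★
`MeasureTheory.Group.covolume_count_eq_mul_of_mulEquiv_prod` (`LatticeCovolumeProd`, hypothesis `hΛe : e g ∈ Λ ↔ g ∈ Γ₁ × Γ₂`) applies to the
adelic centraliser `U(H)(𝔸)_γ ≃ₜ* U(H_a)(𝔸) × U(H_b)(𝔸)` of a singular semisimple `γ` (★ `UnitaryGroupAdelicCentralizerProduct`).

## References
* V. Platonov, A. Rapinchuk, *Algebraic Groups and Number Theory*, Academic Press (1994), §5.1. [PlatonovRapinchuk1994]
* J. Rogawski, *Automorphic Representations of Unitary Groups in Three Variables*, Ann. of Math. Stud. 123 (1990), §3.8 Prop. 3.8.1 (a)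
  p. 27; §14.5 Lemma 14.5.2 (b) pp. 238–239. [Rogawski1990]
-/

noncomputable section

open scoped MatrixGroups Matrix
open NumberField IsDedekindDomain

namespace Literature.NumberTheory.Automorphic.UnitaryGroup

/-! ## §1 Entries of a block-diagonal matrix -/

section Algebra

variable {S : Type*} [CommRing S] {N₁ N₂ : ℕ}

/-- The `(inl i, inl j)` entry of `A ⊕ᶠ B` is `A i j`. [folklore] -/
private theorem finSum_apply_inl_inl (A : Matrix (Fin N₁) (Fin N₁) S) (B : Matrix (Fin N₂) (Fin N₂) S) (i j : Fin N₁) :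
    finSum N₁ N₂ A B (finSumFinEquiv (Sum.inl i)) (finSumFinEquiv (Sum.inl j)) = A i j := by
  simp only [finSum, Matrix.reindex_apply, Matrix.submatrix_apply, Equiv.symm_apply_apply, Matrix.fromBlocks_apply₁₁]

/-- The `(inr i, inr j)` entry of `A ⊕ᶠ B` is `B i j`. [folklore] -/
private theorem finSum_apply_inr_inr (A : Matrix (Fin N₁) (Fin N₁) S) (B : Matrix (Fin N₂) (Fin N₂) S) (i j : Fin N₂) :
    finSum N₁ N₂ A B (finSumFinEquiv (Sum.inr i)) (finSumFinEquiv (Sum.inr j)) = B i j := by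
  simp only [finSum, Matrix.reindex_apply, Matrix.submatrix_apply, Equiv.symm_apply_apply, Matrix.fromBlocks_apply₂₂]

/-- **The entries of `A ⊕ᶠ B` lie in `s` (a subring ∕ subalgebra ∕ any carrier containing `0`) iff the entries of `A` and of `B` do** (the off-diagonal
blocks vanish).
[cite: PlatonovRapinchuk1994, §5.1] -/
theorem forall_finSum_apply_mem_iff {σ : Type*} [SetLike σ S] [ZeroMemClass σ S] (s : σ) (A : Matrix (Fin N₁) (Fin N₁) S)
    (B : Matrix (Fin N₂) (Fin N₂) S) :
    (∀ i j, finSum N₁ N₂ A B i j ∈ s) ↔ (∀ i j, A i j ∈ s) ∧ ∀ i j, B i j ∈ s := by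
  constructor
  · intro h
    refine ⟨fun i j => ?_, fun i j => ?_⟩
    · rw [← finSum_apply_inl_inl A B i j]; exact h _ _
    · rw [← finSum_apply_inr_inr A B i j]; exact h _ _
  · rintro ⟨hA, hB⟩ i j
    rw [← finSumFinEquiv.apply_symm_apply i, ← finSumFinEquiv.apply_symm_apply j]
    rcases finSumFinEquiv.symm i with i₁ | i₂ <;> rcases finSumFinEquiv.symm j with j₁ | j₂
    · rw [finSum_apply_inl_inl]; exact hA _ _
    · simp only [finSum, Matrix.reindex_apply, Matrix.submatrix_apply, Equiv.symm_apply_apply, Matrix.fromBlocks_apply₁₂,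
        Matrix.zero_apply]; exact zero_mem s
    · simp only [finSum, Matrix.reindex_apply, Matrix.submatrix_apply, Equiv.symm_apply_apply, Matrix.fromBlocks_apply₂₁,
        Matrix.zero_apply]; exact zero_mem s
    · rw [finSum_apply_inr_inr]; exact hB _ _

omit [CommRing S] in
/-- **Matrices are detected by an injective map on entries**: `X.map f = Y.map f → X = Y` for injective `f` (used to pull a commutation
relation back from `M(𝔸_E)` to `M(E)` along the diagonal embedding). [folklore] -/
private theorem eq_of_map_eq_map {T : Type*} {m n : Type*} {f : S → T} (hf : Function.Injective f) {X Y : Matrix m n S}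
    (h : X.map f = Y.map f) : X = Y :=
  Matrix.ext fun i j => hf (by rw [← Matrix.map_apply (f := f), h, Matrix.map_apply])

end Algebra

/-! ## §2 The integral level is read blockwise -/

section Level

variable (F E : Type) [Field F] [NumberField F] [Field E] [NumberField E] [Algebra F E]
variable (c : E ≃ₐ[F] E) (M₁ M₂ : ℕ) (J₁ : Matrix (Fin M₁) (Fin M₁) E) (J₂ : Matrix (Fin M₂) (Fin M₂) E)

omit [NumberField F] in
/-- The matrix of `finAdelicBlockDiag (u₁, u₂)` is `u₁ ⊕ᶠ u₂`. [folklore] -/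
private theorem coe_coe_finAdelicBlockDiag (u₁ : finAdelic F E c M₁ J₁) (u₂ : finAdelic F E c M₂ J₂) :
    (((finAdelicBlockDiag F E c M₁ M₂ J₁ J₂ (u₁, u₂) : finAdelic F E c (M₁ + M₂) (finSum M₁ M₂ J₁ J₂)) :
        GL (Fin (M₁ + M₂)) (FiniteAdeleRing (𝓞 E) E)) : Matrix (Fin (M₁ + M₂)) (Fin (M₁ + M₂)) (FiniteAdeleRing (𝓞 E) E)) =
      finSum M₁ M₂ ((u₁ : GL (Fin M₁) (FiniteAdeleRing (𝓞 E) E)) : Matrix (Fin M₁) (Fin M₁) (FiniteAdeleRing (𝓞 E) E))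
        ((u₂ : GL (Fin M₂) (FiniteAdeleRing (𝓞 E) E)) : Matrix (Fin M₂) (Fin M₂) (FiniteAdeleRing (𝓞 E) E)) := by
  rw [coe_finAdelicBlockDiag, coe_reindexGL, coe_blockDiagGL]
  rfl

omit [NumberField F] in
/-- The matrix of `(finAdelicBlockDiag (u₁, u₂))⁻¹` is `u₁⁻¹ ⊕ᶠ u₂⁻¹`. [folklore] -/
private theorem coe_coe_finAdelicBlockDiag_inv (u₁ : finAdelic F E c M₁ J₁) (u₂ : finAdelic F E c M₂ J₂) :
    ((((finAdelicBlockDiag F E c M₁ M₂ J₁ J₂ (u₁, u₂) : finAdelic F E c (M₁ + M₂) (finSum M₁ M₂ J₁ J₂)) :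
        GL (Fin (M₁ + M₂)) (FiniteAdeleRing (𝓞 E) E))⁻¹ : GL (Fin (M₁ + M₂)) (FiniteAdeleRing (𝓞 E) E)) :
          Matrix (Fin (M₁ + M₂)) (Fin (M₁ + M₂)) (FiniteAdeleRing (𝓞 E) E)) =
      finSum M₁ M₂ (((u₁ : GL (Fin M₁) (FiniteAdeleRing (𝓞 E) E))⁻¹ : GL (Fin M₁) (FiniteAdeleRing (𝓞 E) E)) :
          Matrix (Fin M₁) (Fin M₁) (FiniteAdeleRing (𝓞 E) E))
        (((u₂ : GL (Fin M₂) (FiniteAdeleRing (𝓞 E) E))⁻¹ : GL (Fin M₂) (FiniteAdeleRing (𝓞 E) E)) :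
          Matrix (Fin M₂) (Fin M₂) (FiniteAdeleRing (𝓞 E) E)) := by
  rw [← Subgroup.coe_inv, ← map_inv, Prod.inv_mk, coe_coe_finAdelicBlockDiag]
  rfl

omit [NumberField F] in
/-- **The integral level is read blockwise**: `u₁ ⊕ᶠ u₂ ∈ K_f⁰(J₁ ⊕ᶠ J₂) = U(J₁ ⊕ᶠ J₂)(𝔸_{F,f}) ∩ GL_{M₁+M₂}(𝒪̂_E)` iff
`u₁ ∈ K_f⁰(J₁)` and `u₂ ∈ K_f⁰(J₂)` — membership in `GL(𝒪̂_E)` is «all entries of `g` and of `g⁻¹` are integral», and the entries of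
`u₁ ⊕ᶠ u₂`, `(u₁ ⊕ᶠ u₂)⁻¹ = u₁⁻¹ ⊕ᶠ u₂⁻¹` are those of the blocks together with zeros. [cite: PlatonovRapinchuk1994, §5.1] -/
theorem finAdelicBlockDiag_mem_finAdelicIntegralLevel_iff (u₁ : finAdelic F E c M₁ J₁) (u₂ : finAdelic F E c M₂ J₂) :
    finAdelicBlockDiag F E c M₁ M₂ J₁ J₂ (u₁, u₂) ∈ finAdelicIntegralLevel F E c (M₁ + M₂) (finSum M₁ M₂ J₁ J₂) ↔
      u₁ ∈ finAdelicIntegralLevel F E c M₁ J₁ ∧ u₂ ∈ finAdelicIntegralLevel F E c M₂ J₂ := by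
  simp only [mem_finAdelicIntegralLevel_iff, mem_glFiniteIntegralLevel_iff]
  rw [coe_coe_finAdelicBlockDiag, coe_coe_finAdelicBlockDiag_inv, forall_finSum_apply_mem_iff, forall_finSum_apply_mem_iff]
  tauto

omit [NumberField F] in
/-- Subgroup form: **`K_f⁰(J₁ ⊕ᶠ J₂)` pulls back to `K_f⁰(J₁) × K_f⁰(J₂)`** along `finAdelicBlockDiag`. [cite: PlatonovRapinchuk1994, §5.1] -/
theorem comap_finAdelicBlockDiag_finAdelicIntegralLevel :
    (finAdelicIntegralLevel F E c (M₁ + M₂) (finSum M₁ M₂ J₁ J₂)).comap (finAdelicBlockDiag F E c M₁ M₂ J₁ J₂) =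
      (finAdelicIntegralLevel F E c M₁ J₁).prod (finAdelicIntegralLevel F E c M₂ J₂) := by
  ext u
  rw [Subgroup.mem_comap, Subgroup.mem_prod]
  exact finAdelicBlockDiag_mem_finAdelicIntegralLevel_iff F E c M₁ M₂ J₁ J₂ u.1 u.2

end Level

/-! ## §3 Rational points are read blockwise -/

section Rational

variable (F E : Type) [Field F] [NumberField F] [Field E] [NumberField E] [Algebra F E]
variable (c : E ≃ₐ[F] E) (M₁ M₂ : ℕ) (J₁ : Matrix (Fin M₁) (Fin M₁) E) (J₂ : Matrix (Fin M₂) (Fin M₂) E)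

omit [NumberField F] in
/-- `E → 𝔸_E^∞` is injective (read at one finite place; private copy, as in ★ `UnitaryShimuraCurveCentralTranslate`). [folklore] -/
private theorem algebraMap_finiteAdeleRing_injective : Function.Injective (algebraMap E (FiniteAdeleRing (𝓞 E) E)) := by
  obtain ⟨P, hP⟩ := Ideal.exists_maximal (𝓞 E)
  let v : HeightOneSpectrum (𝓞 E) :=
    ⟨P, hP.isPrime, Ring.ne_bot_of_isMaximal_of_not_isField hP (RingOfIntegers.not_isField E)⟩
  intro x y hxy
  have h := congrArg (fun z : FiniteAdeleRing (𝓞 E) E => z v) hxy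
  simp only [FiniteAdeleRing.algebraMap_apply] at h
  exact (algebraMap E (v.adicCompletion E)).injective h

omit [NumberField F] [NumberField E] in
/-- `0 − 1` is a unit of the field `E` (the block scalar `0 ⊕ᶠ 1` separates the blocks). [folklore] -/
private theorem isUnit_zero_sub_one : IsUnit ((0 : E) - 1) := by
  rw [zero_sub]
  exact isUnit_one.neg

omit [NumberField F] [NumberField E] in
/-- **A rational point of `U(J₁ ⊕ᶠ J₂)(F)` whose matrix commutes with `0 ⊕ᶠ 1` is `γ₁ ⊕ᶠ γ₂` with `γᵢ ∈ U(Jᵢ)(F)`**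
(★ `mem_range_blockDiagFin_iff_commute` over `E`). [cite: Rogawski1990, §3.8 Prop. 3.8.1 p. 27] -/
theorem mem_range_rationalBlockDiag_of_commute (γ : rational F E c (M₁ + M₂) (finSum M₁ M₂ J₁ J₂))
    (hγ : ((γ : GL (Fin (M₁ + M₂)) E) : Matrix (Fin (M₁ + M₂)) (Fin (M₁ + M₂)) E) *
        finSum M₁ M₂ (0 : Matrix (Fin M₁) (Fin M₁) E) (1 : Matrix (Fin M₂) (Fin M₂) E) =
      finSum M₁ M₂ (0 : Matrix (Fin M₁) (Fin M₁) E) (1 : Matrix (Fin M₂) (Fin M₂) E) *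
        ((γ : GL (Fin (M₁ + M₂)) E) : Matrix (Fin (M₁ + M₂)) (Fin (M₁ + M₂)) E)) :
    γ ∈ (rationalBlockDiag F E c M₁ M₂ J₁ J₂).range := by
  have key := mem_range_blockDiagFin_iff_commute (c : E →+* E) J₁ J₂ (isUnit_zero_sub_one E) γ
  simp only [zero_smul, one_smul] at key
  exact key.2 hγ

omit [NumberField F] in
/-- **Rational points are read blockwise** (full adeles): `u₁ ⊕ᶠ u₂ ∈ U(J₁ ⊕ᶠ J₂)(F)` (the image of ★ `toAdelic`) iff
`u₁ ∈ U(J₁)(F)` and `u₂ ∈ U(J₂)(F)`.  (⇐) ★ `adelicBlockDiag_toAdelic_mem_range`.  (⇒) if `γ ⊗ 1 = u₁ ⊕ᶠ u₂` with `γ` rational, then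
`γ ⊗ 1` commutes with `0 ⊕ᶠ 1 = (0 ⊕ᶠ 1) ⊗ 1`, hence so does `γ` (`E → 𝔸_E` is injective), so `γ = γ₁ ⊕ᶠ γ₂` with `γᵢ` rational, and
`γᵢ ⊗ 1 = uᵢ` because `⊕ᶠ` is injective. [cite: PlatonovRapinchuk1994, §5.1] [cite: Rogawski1990, §14.5 Lemma 14.5.2 (b) p. 238] -/
theorem adelicBlockDiag_mem_range_toAdelic_iff (u₁ : adelic F E c M₁ J₁) (u₂ : adelic F E c M₂ J₂) :
    adelicBlockDiag F E c M₁ M₂ J₁ J₂ (u₁, u₂) ∈ (toAdelic F E c (M₁ + M₂) (finSum M₁ M₂ J₁ J₂)).range ↔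
      u₁ ∈ (toAdelic F E c M₁ J₁).range ∧ u₂ ∈ (toAdelic F E c M₂ J₂).range := by
  constructor
  · rintro ⟨γ, hγ⟩
    -- the matrix identity `γ ⊗ 1 = u₁ ⊕ᶠ u₂`
    have hm : ((γ : GL (Fin (M₁ + M₂)) E) : Matrix (Fin (M₁ + M₂)) (Fin (M₁ + M₂)) E).map (algebraMap E (AdeleRing (𝓞 E) E)) =
        finSum M₁ M₂ ((u₁ : GL (Fin M₁) (AdeleRing (𝓞 E) E)) : Matrix (Fin M₁) (Fin M₁) (AdeleRing (𝓞 E) E))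
          ((u₂ : GL (Fin M₂) (AdeleRing (𝓞 E) E)) : Matrix (Fin M₂) (Fin M₂) (AdeleRing (𝓞 E) E)) := by
      have h := congrArg (fun w : adelic F E c (M₁ + M₂) (finSum M₁ M₂ J₁ J₂) =>
        ((w : GL (Fin (M₁ + M₂)) (AdeleRing (𝓞 E) E)) : Matrix (Fin (M₁ + M₂)) (Fin (M₁ + M₂)) (AdeleRing (𝓞 E) E))) hγ
      simp only [coe_adelicBlockDiag, coe_reindexGL, coe_blockDiagGL] at h
      exact h
    -- `γ` commutes with `0 ⊕ᶠ 1` over `E`: push through the injective `E → 𝔸_E`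
    have hD : (finSum M₁ M₂ (0 : Matrix (Fin M₁) (Fin M₁) E) (1 : Matrix (Fin M₂) (Fin M₂) E)).map (algebraMap E (AdeleRing (𝓞 E) E)) =
        finSum M₁ M₂ (0 : Matrix (Fin M₁) (Fin M₁) (AdeleRing (𝓞 E) E)) (1 : Matrix (Fin M₂) (Fin M₂) (AdeleRing (𝓞 E) E)) := by
      rw [finSum_map, Matrix.map_zero _ (map_zero _), Matrix.map_one _ (map_zero _) (map_one _)]
    have hcommA : finSum M₁ M₂ ((u₁ : GL (Fin M₁) (AdeleRing (𝓞 E) E)) : Matrix (Fin M₁) (Fin M₁) (AdeleRing (𝓞 E) E))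
          ((u₂ : GL (Fin M₂) (AdeleRing (𝓞 E) E)) : Matrix (Fin M₂) (Fin M₂) (AdeleRing (𝓞 E) E)) *
          finSum M₁ M₂ (0 : Matrix (Fin M₁) (Fin M₁) (AdeleRing (𝓞 E) E)) (1 : Matrix (Fin M₂) (Fin M₂) (AdeleRing (𝓞 E) E)) =
        finSum M₁ M₂ (0 : Matrix (Fin M₁) (Fin M₁) (AdeleRing (𝓞 E) E)) (1 : Matrix (Fin M₂) (Fin M₂) (AdeleRing (𝓞 E) E)) *
          finSum M₁ M₂ ((u₁ : GL (Fin M₁) (AdeleRing (𝓞 E) E)) : Matrix (Fin M₁) (Fin M₁) (AdeleRing (𝓞 E) E))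
            ((u₂ : GL (Fin M₂) (AdeleRing (𝓞 E) E)) : Matrix (Fin M₂) (Fin M₂) (AdeleRing (𝓞 E) E)) := by
      have h := finSum_commute_finSum_smul_one (0 : AdeleRing (𝓞 E) E) 1
        ((u₁ : GL (Fin M₁) (AdeleRing (𝓞 E) E)) : Matrix (Fin M₁) (Fin M₁) (AdeleRing (𝓞 E) E))
        ((u₂ : GL (Fin M₂) (AdeleRing (𝓞 E) E)) : Matrix (Fin M₂) (Fin M₂) (AdeleRing (𝓞 E) E))
      simp only [zero_smul, one_smul] at h
      exact h
    have hcomm : ((γ : GL (Fin (M₁ + M₂)) E) : Matrix (Fin (M₁ + M₂)) (Fin (M₁ + M₂)) E) *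
          finSum M₁ M₂ (0 : Matrix (Fin M₁) (Fin M₁) E) (1 : Matrix (Fin M₂) (Fin M₂) E) =
        finSum M₁ M₂ (0 : Matrix (Fin M₁) (Fin M₁) E) (1 : Matrix (Fin M₂) (Fin M₂) E) *
          ((γ : GL (Fin (M₁ + M₂)) E) : Matrix (Fin (M₁ + M₂)) (Fin (M₁ + M₂)) E) := by
      refine eq_of_map_eq_map (AdeleRing.algebraMap_injective (𝓞 E) E) ?_
      rw [Matrix.map_mul, Matrix.map_mul, hD, hm]
      exact hcommA
    -- so `γ = γ₁ ⊕ᶠ γ₂` with rational blocks, and `γᵢ ⊗ 1 = uᵢ`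
    obtain ⟨⟨γ₁, γ₂⟩, hγ'⟩ := mem_range_rationalBlockDiag_of_commute F E c M₁ M₂ J₁ J₂ γ hcomm
    have h2 : adelicBlockDiag F E c M₁ M₂ J₁ J₂ (toAdelic F E c M₁ J₁ γ₁, toAdelic F E c M₂ J₂ γ₂) =
        adelicBlockDiag F E c M₁ M₂ J₁ J₂ (u₁, u₂) := by
      rw [adelicBlockDiag_toAdelic, hγ', hγ]
    have h3 := adelicBlockDiag_injective F E c M₁ M₂ J₁ J₂ h2
    rw [Prod.mk.injEq] at h3
    exact ⟨⟨γ₁, h3.1⟩, ⟨γ₂, h3.2⟩⟩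
  · rintro ⟨⟨γ₁, rfl⟩, ⟨γ₂, rfl⟩⟩
    exact adelicBlockDiag_toAdelic_mem_range F E c M₁ M₂ J₁ J₂ γ₁ γ₂

omit [NumberField F] in
/-- Subgroup form: **`U(J₁ ⊕ᶠ J₂)(F)` pulls back to `U(J₁)(F) × U(J₂)(F)`** along `adelicBlockDiag` (the hypothesis shape `hΛe` of ★
`covolume_count_eq_mul_of_mulEquiv_prod`). [cite: PlatonovRapinchuk1994, §5.1] [cite: Rogawski1990, §14.5 Lemma 14.5.2 (b) p. 238] -/
theorem comap_adelicBlockDiag_range_toAdelic :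
    (toAdelic F E c (M₁ + M₂) (finSum M₁ M₂ J₁ J₂)).range.comap (adelicBlockDiag F E c M₁ M₂ J₁ J₂) =
      (toAdelic F E c M₁ J₁).range.prod (toAdelic F E c M₂ J₂).range := by
  ext u
  rw [Subgroup.mem_comap, Subgroup.mem_prod]
  exact adelicBlockDiag_mem_range_toAdelic_iff F E c M₁ M₂ J₁ J₂ u.1 u.2

omit [NumberField F] in
/-- **Rational points are read blockwise** (finite adeles): `u₁ ⊕ᶠ u₂ ∈ U(J₁ ⊕ᶠ J₂)(F)` (the image of ★ `rationalToFinAdelic`) iff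
`u₁ ∈ U(J₁)(F)` and `u₂ ∈ U(J₂)(F)` — the same argument over `𝔸_E^∞` (`E → 𝔸_E^∞` injective).
[cite: PlatonovRapinchuk1994, §5.1] -/
theorem finAdelicBlockDiag_mem_range_rationalToFinAdelic_iff (u₁ : finAdelic F E c M₁ J₁) (u₂ : finAdelic F E c M₂ J₂) :
    finAdelicBlockDiag F E c M₁ M₂ J₁ J₂ (u₁, u₂) ∈ (rationalToFinAdelic F E c (M₁ + M₂) (finSum M₁ M₂ J₁ J₂)).range ↔
      u₁ ∈ (rationalToFinAdelic F E c M₁ J₁).range ∧ u₂ ∈ (rationalToFinAdelic F E c M₂ J₂).range := by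
  constructor
  · rintro ⟨γ, hγ⟩
    have hinj : Function.Injective (algebraMap E (FiniteAdeleRing (𝓞 E) E)) := algebraMap_finiteAdeleRing_injective E
    have hm : ((γ : GL (Fin (M₁ + M₂)) E) : Matrix (Fin (M₁ + M₂)) (Fin (M₁ + M₂)) E).map (algebraMap E (FiniteAdeleRing (𝓞 E) E)) =
        finSum M₁ M₂ ((u₁ : GL (Fin M₁) (FiniteAdeleRing (𝓞 E) E)) : Matrix (Fin M₁) (Fin M₁) (FiniteAdeleRing (𝓞 E) E))
          ((u₂ : GL (Fin M₂) (FiniteAdeleRing (𝓞 E) E)) : Matrix (Fin M₂) (Fin M₂) (FiniteAdeleRing (𝓞 E) E)) := by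
      have h := congrArg (fun w : finAdelic F E c (M₁ + M₂) (finSum M₁ M₂ J₁ J₂) =>
        ((w : GL (Fin (M₁ + M₂)) (FiniteAdeleRing (𝓞 E) E)) : Matrix (Fin (M₁ + M₂)) (Fin (M₁ + M₂)) (FiniteAdeleRing (𝓞 E) E))) hγ
      rw [coe_coe_finAdelicBlockDiag, coe_rationalToFinAdelic] at h
      exact h
    have hD : (finSum M₁ M₂ (0 : Matrix (Fin M₁) (Fin M₁) E) (1 : Matrix (Fin M₂) (Fin M₂) E)).map
          (algebraMap E (FiniteAdeleRing (𝓞 E) E)) =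
        finSum M₁ M₂ (0 : Matrix (Fin M₁) (Fin M₁) (FiniteAdeleRing (𝓞 E) E)) (1 : Matrix (Fin M₂) (Fin M₂) (FiniteAdeleRing (𝓞 E) E)) := by
      rw [finSum_map, Matrix.map_zero _ (map_zero _), Matrix.map_one _ (map_zero _) (map_one _)]
    have hcommA : finSum M₁ M₂ ((u₁ : GL (Fin M₁) (FiniteAdeleRing (𝓞 E) E)) : Matrix (Fin M₁) (Fin M₁) (FiniteAdeleRing (𝓞 E) E))
          ((u₂ : GL (Fin M₂) (FiniteAdeleRing (𝓞 E) E)) : Matrix (Fin M₂) (Fin M₂) (FiniteAdeleRing (𝓞 E) E)) *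
          finSum M₁ M₂ (0 : Matrix (Fin M₁) (Fin M₁) (FiniteAdeleRing (𝓞 E) E)) (1 : Matrix (Fin M₂) (Fin M₂) (FiniteAdeleRing (𝓞 E) E)) =
        finSum M₁ M₂ (0 : Matrix (Fin M₁) (Fin M₁) (FiniteAdeleRing (𝓞 E) E)) (1 : Matrix (Fin M₂) (Fin M₂) (FiniteAdeleRing (𝓞 E) E)) *
          finSum M₁ M₂ ((u₁ : GL (Fin M₁) (FiniteAdeleRing (𝓞 E) E)) : Matrix (Fin M₁) (Fin M₁) (FiniteAdeleRing (𝓞 E) E))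
            ((u₂ : GL (Fin M₂) (FiniteAdeleRing (𝓞 E) E)) : Matrix (Fin M₂) (Fin M₂) (FiniteAdeleRing (𝓞 E) E)) := by
      have h := finSum_commute_finSum_smul_one (0 : FiniteAdeleRing (𝓞 E) E) 1
        ((u₁ : GL (Fin M₁) (FiniteAdeleRing (𝓞 E) E)) : Matrix (Fin M₁) (Fin M₁) (FiniteAdeleRing (𝓞 E) E))
        ((u₂ : GL (Fin M₂) (FiniteAdeleRing (𝓞 E) E)) : Matrix (Fin M₂) (Fin M₂) (FiniteAdeleRing (𝓞 E) E))
      simp only [zero_smul, one_smul] at h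
      exact h
    have hcomm : ((γ : GL (Fin (M₁ + M₂)) E) : Matrix (Fin (M₁ + M₂)) (Fin (M₁ + M₂)) E) *
          finSum M₁ M₂ (0 : Matrix (Fin M₁) (Fin M₁) E) (1 : Matrix (Fin M₂) (Fin M₂) E) =
        finSum M₁ M₂ (0 : Matrix (Fin M₁) (Fin M₁) E) (1 : Matrix (Fin M₂) (Fin M₂) E) *
          ((γ : GL (Fin (M₁ + M₂)) E) : Matrix (Fin (M₁ + M₂)) (Fin (M₁ + M₂)) E) := by
      refine eq_of_map_eq_map hinj ?_
      rw [Matrix.map_mul, Matrix.map_mul, hD, hm]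
      exact hcommA
    obtain ⟨⟨γ₁, γ₂⟩, hγ'⟩ := mem_range_rationalBlockDiag_of_commute F E c M₁ M₂ J₁ J₂ γ hcomm
    have h2 : finAdelicBlockDiag F E c M₁ M₂ J₁ J₂ (rationalToFinAdelic F E c M₁ J₁ γ₁, rationalToFinAdelic F E c M₂ J₂ γ₂) =
        finAdelicBlockDiag F E c M₁ M₂ J₁ J₂ (u₁, u₂) := by
      rw [finAdelicBlockDiag_rationalToFinAdelic, hγ', hγ]
    have h3 := finAdelicBlockDiag_injective F E c M₁ M₂ J₁ J₂ h2
    rw [Prod.mk.injEq] at h3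
    exact ⟨⟨γ₁, h3.1⟩, ⟨γ₂, h3.2⟩⟩
  · rintro ⟨⟨γ₁, rfl⟩, ⟨γ₂, rfl⟩⟩
    exact finAdelicBlockDiag_rationalToFinAdelic_mem_range F E c M₁ M₂ J₁ J₂ γ₁ γ₂

omit [NumberField F] in
/-- Subgroup form (finite adeles): **`U(J₁ ⊕ᶠ J₂)(F)` pulls back to `U(J₁)(F) × U(J₂)(F)`** along `finAdelicBlockDiag`.
[cite: PlatonovRapinchuk1994, §5.1] -/
theorem comap_finAdelicBlockDiag_range_rationalToFinAdelic :
    (rationalToFinAdelic F E c (M₁ + M₂) (finSum M₁ M₂ J₁ J₂)).range.comap (finAdelicBlockDiag F E c M₁ M₂ J₁ J₂) =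
      (rationalToFinAdelic F E c M₁ J₁).range.prod (rationalToFinAdelic F E c M₂ J₂).range := by
  ext u
  rw [Subgroup.mem_comap, Subgroup.mem_prod]
  exact finAdelicBlockDiag_mem_range_rationalToFinAdelic_iff F E c M₁ M₂ J₁ J₂ u.1 u.2

end Rational

end Literature.NumberTheory.Automorphic.UnitaryGroup

end
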